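import Literature.NumberTheory.ConnesConsani2023.ZetaCyclesFiniteSections
import Literature.NumberTheory.LFunctions.YoshidaWindowFourierSeries
import HarnessLib

/-!
# ζ-cycles, §2.1.2, Lemma 2.2 — step (2.19): Fourier truncation in the energy norm

RH-FREE (label, line 1).  Fourth proof file of
`Literature/NumberTheory/ConnesConsani2023/ZetaCyclesSemilocalForm.lean` (Connes–Consani, *Spectral
triples and ζ-cycles*, Enseign. Math. **69** (2023), proof of Lemma 2.2, p. 105
[cite: ConnesConsani2023, Lemma 2.2 eq. (2.19) p. 105]).  The printed proof of the CORE property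
(Lemma 2.2: `E = ∪_N E_N` is a core of `QW_λ` for the graph norm `‖ξ‖² + ‖ξ̂‖₁²`) has three steps:
(2.17) dilation, (2.18) mollification, (2.19) truncation of the Fourier series of a smooth function on the
window in the weighted norm `‖f‖₁² = ∫ |f̂(s)|²(1 + log(1+s²)) ds`, using `‖Û^k‖₁² = O(log|k|)` against the
rapid decay of the Fourier coefficients.  This file PROVES step (2.19) in the tree's vocabulary:

* `tendsto_logSobolevEnergy_sub_proj`: for `φ ∈ K(a)` (restriction to `[−a, a]` of a smooth
  `2a`-periodic function — in particular every `C_c^∞` function supported inside the window),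
  `‖(φ − proj a N φ)^‖₁² → 0` as `N → ∞`, where `proj a N φ ∈ W a N = E_N` is the truncated Fourier
  series.

Route (all PROVED, no named fact): Fatou for the energy along `L¹`-convergent window sequences
(`logSobolevEnergy_le_liminf_of_tendsto_integral_norm`, so that the energy of the infinite tail is bounded
by the `liminf` of the energies of the finite tails `proj_M φ − proj_N φ`); the transform and a weighted
Cauchy–Schwarz bound for the energy of a finite combination of the `χ_n`
(`logSobolevEnergy_sum_chi_le`); the growth bound `‖χ̂_n‖₁² ≤ C(1+|n|)`
(`exists_logSobolevEnergy_chi_le` of `ZetaCyclesFiniteSections.lean`, the paper's `O(log|k|)` being more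
than needed); and the rapid decay `Σ |n|^j |c_n(φ)| < ∞` (`Yoshida1992.summable_pow_mul_norm_fourierCoeff`)
with the uniform convergence of the truncated Fourier series on the window
(`Yoshida1992.norm_sub_trigPoly_le`, `YoshidaWindowFourierSeries.lean`).
Nothing here bears on the truth of the Riemann hypothesis.
-/

noncomputable section

open Complex Filter Set MeasureTheory
open scoped Real Topology ENNReal ComplexConjugate

namespace Literature.NumberTheory.ConnesConsani2023

open Literature.NumberTheory.LFunctions

variable {a : ℝ}

/-! ## §1 Fatou: lower semicontinuity of the energy along `L¹`-convergent window sequences -/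

/-- The log weight `1 + log(1+t²)` is continuous. [cite: ConnesConsani2023, Lemma 2.2 (the norm ‖·‖₁ of (2.14)), p. 104 (arXiv chunk p0007:L5)] -/
private theorem continuous_logWeight : Continuous fun t : ℝ ↦ 1 + Real.log (1 + t ^ 2) :=
  continuous_const.add ((continuous_const.add (continuous_pow 2)).log fun t ↦
    (by positivity : (0 : ℝ) < 1 + t ^ 2).ne')

/-- The log weight is non-negative. [cite: ConnesConsani2023, Lemma 2.2 (the norm ‖·‖₁ of (2.14)), p. 104 (arXiv chunk p0007:L5)] -/
private theorem logWeight_nonneg'' (t : ℝ) : 0 ≤ 1 + Real.log (1 + t ^ 2) := by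
  have := Real.log_nonneg (show (1 : ℝ) ≤ 1 + t ^ 2 by nlinarith [sq_nonneg t])
  linarith

/-- The energy integrand `|η̂(1/2+it)|²(1+log(1+t²))` is measurable for integrable `η`. [cite: ConnesConsani2023, Lemma 2.2 (the norm ‖·‖₁ of (2.14)), p. 104 (arXiv chunk p0007:L5)] -/
theorem measurable_energyIntegrand {η : ℝ → ℂ} (h1 : Integrable η) :
    Measurable fun t : ℝ ↦
      ENNReal.ofReal (‖weilMellin η (1 / 2 + t * I)‖ ^ 2 * (1 + Real.log (1 + t ^ 2))) :=
  ((((continuous_weilMellin_half_line_of_integrable h1).norm).pow 2).mul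
    continuous_logWeight).measurable.ennreal_ofReal

/-- **Fatou for the energy**: if the window functions `u_n → ξ` in `L¹` then
`‖ξ̂‖₁² ≤ liminf ‖û_n‖₁²` (the transforms converge pointwise on the critical line).
[cite: ConnesConsani2023, proof of Lemma 2.2 (the weighted norm ‖·‖₁; arXiv chunk p0007:L40–L46), p. 105] -/
theorem logSobolevEnergy_le_liminf_of_tendsto_integral_norm {ξ : ℝ → ℂ} {u : ℕ → ℝ → ℂ}
    (hξ : MemLp ξ 2 volume) (hξs : Function.support ξ ⊆ Icc (-a) a)
    (hu : ∀ n, MemLp (u n) 2 volume ∧ Function.support (u n) ⊆ Icc (-a) a)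
    (hconv : Tendsto (fun n ↦ ∫ x, ‖u n x - ξ x‖) atTop (𝓝 0)) :
    logSobolevEnergy ξ ≤ liminf (fun n ↦ logSobolevEnergy (u n)) atTop := by
  have hpt : ∀ t : ℝ, Tendsto (fun n ↦ weilMellin (u n) (1 / 2 + t * I)) atTop
      (𝓝 (weilMellin ξ (1 / 2 + t * I))) := by
    intro t
    rw [tendsto_iff_norm_sub_tendsto_zero]
    exact squeeze_zero (fun n ↦ norm_nonneg _)
      (fun n ↦ norm_weilMellin_half_line_sub_le (hu n).1 (hu n).2 hξ hξs t) hconv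
  have hpt' : ∀ t : ℝ, Tendsto (fun n ↦ ENNReal.ofReal
      (‖weilMellin (u n) (1 / 2 + t * I)‖ ^ 2 * (1 + Real.log (1 + t ^ 2)))) atTop
      (𝓝 (ENNReal.ofReal (‖weilMellin ξ (1 / 2 + t * I)‖ ^ 2 * (1 + Real.log (1 + t ^ 2))))) :=
    fun t ↦ ENNReal.tendsto_ofReal ((((hpt t).norm).pow 2).mul_const _)
  have hmeas : ∀ n, AEMeasurable (fun t : ℝ ↦ ENNReal.ofReal
      (‖weilMellin (u n) (1 / 2 + t * I)‖ ^ 2 * (1 + Real.log (1 + t ^ 2)))) volume :=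
    fun n ↦ (measurable_energyIntegrand (integrable_of_memLp_window (hu n).1 (hu n).2)).aemeasurable
  unfold logSobolevEnergy
  calc ∫⁻ s : ℝ, ENNReal.ofReal (‖weilMellin ξ (1 / 2 + s * I)‖ ^ 2 * (1 + Real.log (1 + s ^ 2)))
      = ∫⁻ s : ℝ, liminf (fun n ↦ ENNReal.ofReal
          (‖weilMellin (u n) (1 / 2 + s * I)‖ ^ 2 * (1 + Real.log (1 + s ^ 2)))) atTop :=
        lintegral_congr fun s ↦ ((hpt' s).liminf_eq).symm
    _ ≤ liminf (fun n ↦ ∫⁻ s : ℝ, ENNReal.ofReal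
          (‖weilMellin (u n) (1 / 2 + s * I)‖ ^ 2 * (1 + Real.log (1 + s ^ 2)))) atTop :=
        lintegral_liminf_le' hmeas

/-! ## §2 Transform and energy of a finite combination of the `χ_n` -/

/-- Linearity of the transform on finite combinations of the `χ_n`. [cite: ConnesConsani2023, proof of Lemma 2.2 (η = Σ_{−N}^{N} a_k U^k; arXiv chunk p0007:L58), p. 105] -/
theorem weilMellin_sum_chi (a : ℝ) (S : Finset ℤ) (b : ℤ → ℂ) (s : ℂ) :
    weilMellin (fun x ↦ ∑ n ∈ S, b n * Yoshida1992.chi a n x) s =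
      ∑ n ∈ S, b n * weilMellin (Yoshida1992.chi a n) s := by
  unfold weilMellin
  simp_rw [Finset.sum_mul]
  rw [integral_finsetSum]
  · refine Finset.sum_congr rfl fun n _ ↦ ?_
    rw [← integral_const_mul]
    refine integral_congr_ae (Eventually.of_forall fun x ↦ ?_)
    simp only
    ring
  · intro n _
    have h := (integrable_mul_cexp_window (memLp_chi a n) (support_chi_subset a n)
      (s - 1 / 2)).const_mul (b n)
    refine h.congr (Eventually.of_forall fun x ↦ ?_)
    simp only
    ring

/-- Weighted Cauchy–Schwarz: `|Σ b_n z_n|² ≤ (Σ |b_n| w_n)(Σ (|b_n|/w_n)|z_n|²)` (`w_n > 0`).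
[cite: ConnesConsani2023, proof of Lemma 2.2 (the estimate of Σ a_k Û^k from ‖Û^k‖₁ and the decay of a_k; arXiv chunk p0007:L56–L60), p. 105] -/
private theorem norm_sum_mul_sq_le (S : Finset ℤ) (b : ℤ → ℂ) (z : ℤ → ℂ) {w : ℤ → ℝ}
    (hw : ∀ n, 0 < w n) :
    ‖∑ n ∈ S, b n * z n‖ ^ 2 ≤ (∑ n ∈ S, ‖b n‖ * w n) * ∑ n ∈ S, ‖b n‖ / w n * ‖z n‖ ^ 2 := by
  have h1 : ‖∑ n ∈ S, b n * z n‖ ≤ ∑ n ∈ S, ‖b n‖ * ‖z n‖ :=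
    (norm_sum_le _ _).trans (le_of_eq (Finset.sum_congr rfl fun n _ ↦ norm_mul _ _))
  have h2 : (∑ n ∈ S, ‖b n‖ * ‖z n‖) =
      ∑ n ∈ S, Real.sqrt (‖b n‖ * w n) * (Real.sqrt (‖b n‖ / w n) * ‖z n‖) := by
    refine Finset.sum_congr rfl fun n _ ↦ ?_
    have hwn := hw n
    rw [← mul_assoc, ← Real.sqrt_mul (by positivity : 0 ≤ ‖b n‖ * w n),
      show ‖b n‖ * w n * (‖b n‖ / w n) = ‖b n‖ ^ 2 by field_simp,
      Real.sqrt_sq (norm_nonneg _)]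
  have h3 := Finset.sum_mul_sq_le_sq_mul_sq S (fun n ↦ Real.sqrt (‖b n‖ * w n))
    (fun n ↦ Real.sqrt (‖b n‖ / w n) * ‖z n‖)
  have e1 : ∑ n ∈ S, Real.sqrt (‖b n‖ * w n) ^ 2 = ∑ n ∈ S, ‖b n‖ * w n :=
    Finset.sum_congr rfl fun n _ ↦ Real.sq_sqrt (by have := hw n; positivity)
  have e2 : ∑ n ∈ S, (Real.sqrt (‖b n‖ / w n) * ‖z n‖) ^ 2 = ∑ n ∈ S, ‖b n‖ / w n * ‖z n‖ ^ 2 :=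
    Finset.sum_congr rfl fun n _ ↦ by
      rw [mul_pow, Real.sq_sqrt (by have := hw n; positivity)]
  calc ‖∑ n ∈ S, b n * z n‖ ^ 2 ≤ (∑ n ∈ S, ‖b n‖ * ‖z n‖) ^ 2 :=
        pow_le_pow_left₀ (norm_nonneg _) h1 2
    _ = (∑ n ∈ S, Real.sqrt (‖b n‖ * w n) * (Real.sqrt (‖b n‖ / w n) * ‖z n‖)) ^ 2 := by rw [h2]
    _ ≤ (∑ n ∈ S, Real.sqrt (‖b n‖ * w n) ^ 2) *
          ∑ n ∈ S, (Real.sqrt (‖b n‖ / w n) * ‖z n‖) ^ 2 := h3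
    _ = _ := by rw [e1, e2]

/-- **Energy of a finite combination of the `χ_n`** (weighted Cauchy–Schwarz, any weights `w_n > 0`):
`‖(Σ_S b_n χ_n)^‖₁² ≤ (Σ_S |b_n| w_n) · Σ_S (|b_n|/w_n) ‖χ̂_n‖₁²`.
[cite: ConnesConsani2023, proof of Lemma 2.2 (η_n = Σ a_k U^k with (a_k) of rapid decay and ‖Û^k‖₁² = O(log|k|); arXiv chunk p0007:L50–L60), p. 105] -/
theorem logSobolevEnergy_sum_chi_le (a : ℝ) (S : Finset ℤ) (b : ℤ → ℂ) {w : ℤ → ℝ}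
    (hw : ∀ n, 0 < w n) :
    logSobolevEnergy (fun x ↦ ∑ n ∈ S, b n * Yoshida1992.chi a n x) ≤
      ENNReal.ofReal (∑ n ∈ S, ‖b n‖ * w n) *
        ∑ n ∈ S, ENNReal.ofReal (‖b n‖ / w n) * logSobolevEnergy (Yoshida1992.chi a n) := by
  have hmeas : ∀ n : ℤ, Measurable fun t : ℝ ↦ ENNReal.ofReal
      (‖weilMellin (Yoshida1992.chi a n) (1 / 2 + t * I)‖ ^ 2 * (1 + Real.log (1 + t ^ 2))) :=
    fun n ↦ measurable_energyIntegrand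
      (integrable_of_memLp_window (memLp_chi a n) (support_chi_subset a n))
  have hbw : 0 ≤ ∑ n ∈ S, ‖b n‖ * w n :=
    Finset.sum_nonneg fun n _ ↦ by have := hw n; positivity
  unfold logSobolevEnergy
  calc ∫⁻ s : ℝ, ENNReal.ofReal (‖weilMellin (fun x ↦ ∑ n ∈ S, b n * Yoshida1992.chi a n x)
          (1 / 2 + s * I)‖ ^ 2 * (1 + Real.log (1 + s ^ 2)))
      ≤ ∫⁻ s : ℝ, ENNReal.ofReal ((∑ n ∈ S, ‖b n‖ * w n) *
          ∑ n ∈ S, ‖b n‖ / w n * (‖weilMellin (Yoshida1992.chi a n) (1 / 2 + s * I)‖ ^ 2 *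
            (1 + Real.log (1 + s ^ 2)))) := by
        refine lintegral_mono fun s ↦ ENNReal.ofReal_le_ofReal ?_
        rw [weilMellin_sum_chi]
        have hlw := logWeight_nonneg'' s
        have h := norm_sum_mul_sq_le S b
          (fun n ↦ weilMellin (Yoshida1992.chi a n) (1 / 2 + s * I)) hw
        calc ‖∑ n ∈ S, b n * weilMellin (Yoshida1992.chi a n) (1 / 2 + s * I)‖ ^ 2 *
              (1 + Real.log (1 + s ^ 2))
            ≤ ((∑ n ∈ S, ‖b n‖ * w n) * ∑ n ∈ S, ‖b n‖ / w n *
                ‖weilMellin (Yoshida1992.chi a n) (1 / 2 + s * I)‖ ^ 2) *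
                (1 + Real.log (1 + s ^ 2)) := mul_le_mul_of_nonneg_right h hlw
          _ = _ := by
              rw [mul_assoc]
              congr 1
              rw [Finset.sum_mul]
              exact Finset.sum_congr rfl fun n _ ↦ by ring
    _ = ENNReal.ofReal (∑ n ∈ S, ‖b n‖ * w n) * ∫⁻ s : ℝ, ∑ n ∈ S,
          ENNReal.ofReal (‖b n‖ / w n) * ENNReal.ofReal
            (‖weilMellin (Yoshida1992.chi a n) (1 / 2 + s * I)‖ ^ 2 *
              (1 + Real.log (1 + s ^ 2))) := by
        rw [← lintegral_const_mul' _ _ ENNReal.ofReal_ne_top]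
        refine lintegral_congr fun s ↦ ?_
        have hterm : ∀ n ∈ S, 0 ≤ ‖b n‖ / w n *
            (‖weilMellin (Yoshida1992.chi a n) (1 / 2 + s * I)‖ ^ 2 * (1 + Real.log (1 + s ^ 2))) :=
          fun n _ ↦ by have := hw n; have := logWeight_nonneg'' s; positivity
        rw [ENNReal.ofReal_mul hbw, ENNReal.ofReal_sum_of_nonneg hterm]
        congr 1
        exact Finset.sum_congr rfl fun n _ ↦
          ENNReal.ofReal_mul (by have := hw n; positivity)
    _ = _ := by
        congr 1
        rw [lintegral_finsetSum' _ (fun n _ ↦ ((hmeas n).const_mul _).aemeasurable)]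
        exact Finset.sum_congr rfl fun n _ ↦ lintegral_const_mul _ (hmeas n)

/-! ## §3 The finite tails `proj_M φ − proj_N φ` and the `L¹` convergence `proj_M φ → φ` on `K(a)` -/

/-- `proj_M φ − proj_N φ = Σ_{N < |n| ≤ M} (2a)^{-1/2} c_n χ_n` (`N ≤ M`). [cite: ConnesConsani2023, proof of Lemma 2.2 (η = Σ_{−N}^{N} a_k U^k; arXiv chunk p0007:L58), p. 105] -/
theorem proj_sub_proj_eq_sum (a : ℝ) {N M : ℕ} (hNM : N ≤ M) (φ : ℝ → ℂ) (x : ℝ) :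
    Yoshida1992.proj a M φ x - Yoshida1992.proj a N φ x =
      ∑ n ∈ Yoshida1992.modes M \ Yoshida1992.modes N,
        (((1 / Real.sqrt (2 * a) : ℝ) : ℂ) * Yoshida1992.fourierCoeff a n φ) *
          Yoshida1992.chi a n x := by
  have hsub : Yoshida1992.modes N ⊆ Yoshida1992.modes M := fun n hn ↦ by
    rw [Yoshida1992.mem_modes] at hn ⊢
    exact hn.trans (by exact_mod_cast hNM)
  unfold Yoshida1992.proj
  simp only [Finset.sum_apply, Pi.smul_apply, smul_eq_mul]
  rw [← Finset.sum_sdiff hsub, add_sub_cancel_right]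

/-- An element of `K(a)` is a window-supported square-integrable function. [cite: ConnesConsani2023, Prop. 2.3 (E ⊂ C_c^∞ ⊂ L²([λ⁻¹,λ], d*u)), p. 106 (arXiv chunk p0007:L74)] -/
theorem memLp_and_support_of_mem_K {φ : ℝ → ℂ} (hφ : φ ∈ Yoshida1992.K a) :
    MemLp φ 2 volume ∧ Function.support φ ⊆ Icc (-a) a := by
  obtain ⟨f, hf, -, hφf, hφ0⟩ := hφ
  have e : φ = (Icc (-a) a).indicator f := by
    funext x
    by_cases hx : x ∈ Icc (-a) a
    · rw [indicator_of_mem hx]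
      exact hφf x (abs_le.2 ⟨hx.1, hx.2⟩)
    · rw [indicator_of_notMem hx]
      refine hφ0 x ?_
      rw [mem_Icc, ← abs_le, not_le] at hx
      exact hx
  refine ⟨?_, ?_⟩
  · rw [e]
    have hmeas : AEStronglyMeasurable ((Icc (-a) a).indicator f) volume :=
      hf.continuous.aestronglyMeasurable.indicator measurableSet_Icc
    rw [memLp_two_iff_integrable_sq_norm hmeas]
    have e2 : (fun x ↦ ‖(Icc (-a) a).indicator f x‖ ^ 2) =
        (Icc (-a) a).indicator (fun x ↦ ‖f x‖ ^ 2) := by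
      funext x
      by_cases hx : x ∈ Icc (-a) a <;> simp [hx]
    rw [e2, integrable_indicator_iff measurableSet_Icc]
    exact (hf.continuous.norm.pow 2).continuousOn.integrableOn_compact isCompact_Icc
  · rw [e]
    exact Set.support_indicator_subset

/-- **`proj_M φ → φ` in `L¹`** for `φ ∈ K(a)` (uniform convergence of the truncated Fourier series on
the window, `Yoshida1992.norm_sub_trigPoly_le`). [cite: ConnesConsani2023, proof of Lemma 2.2 (η_n is a smooth function on the circle, η_n = Σ a_k U^k with rapid decay; arXiv chunk p0007:L50–L52), p. 105] -/
theorem tendsto_integral_norm_proj_sub (ha : 0 < a) {φ : ℝ → ℂ} (hφ : φ ∈ Yoshida1992.K a) :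
    Tendsto (fun M ↦ ∫ x, ‖Yoshida1992.proj a M φ x - φ x‖) atTop (𝓝 0) := by
  set δ : ℕ → ℝ := fun M ↦
    ∑' n : {n // n ∉ Yoshida1992.modes M}, ‖Yoshida1992.fourierCoeff a n φ‖ / (2 * a) with hδ_def
  have hδ : Tendsto δ atTop (𝓝 0) := Yoshida1992.tendsto_tsum_compl_modes a φ
  have hpt : ∀ M x, ‖Yoshida1992.proj a M φ x - φ x‖ ≤ (Icc (-a) a).indicator (fun _ ↦ δ M) x := by
    intro M x
    by_cases hx : x ∈ Icc (-a) a
    · rw [indicator_of_mem hx, Yoshida1992.proj_apply_of_mem ha M φ hx, norm_sub_rev]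
      exact Yoshida1992.norm_sub_trigPoly_le ha hφ M hx
    · have hxa : a < |x| := by
        rw [mem_Icc, ← abs_le, not_le] at hx
        exact hx
      rw [indicator_of_notMem hx, Yoshida1992.proj_apply_of_not_mem ha M φ hx,
        Yoshida1992.eq_zero_of_mem_K hφ hxa, sub_zero, norm_zero]
  have hI : ∀ M, Integrable ((Icc (-a) a).indicator fun _ : ℝ ↦ δ M) := fun M ↦ by
    refine IntegrableOn.integrable_indicator ?_ measurableSet_Icc
    exact integrableOn_const (by rw [Real.volume_Icc]; exact ENNReal.ofReal_ne_top)
  have hbound : ∀ M, ∫ x, ‖Yoshida1992.proj a M φ x - φ x‖ ≤ δ M * (2 * a) := by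
    intro M
    calc ∫ x, ‖Yoshida1992.proj a M φ x - φ x‖
        ≤ ∫ x, (Icc (-a) a).indicator (fun _ ↦ δ M) x :=
          integral_mono_of_nonneg (Eventually.of_forall fun _ ↦ norm_nonneg _) (hI M)
            (Eventually.of_forall (hpt M))
      _ = δ M * (2 * a) := by
          rw [integral_indicator_const _ measurableSet_Icc, Measure.real, Real.volume_Icc,
            ENNReal.toReal_ofReal (by linarith), smul_eq_mul]
          ring
  refine squeeze_zero (fun M ↦ integral_nonneg fun _ ↦ norm_nonneg _) hbound ?_
  simpa using hδ.mul_const (2 * a)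

/-! ## §4 Step (2.19): the truncated Fourier series converges in the energy norm on `K(a)` -/

/-- The index sets `modes N = {|n| ≤ N}` exhaust `ℤ`. [cite: ConnesConsani2023, proof of Lemma 2.2 (η = Σ_{−N}^{N} a_k U^k, N → ∞; arXiv chunk p0007:L58–L60), p. 105] -/
private theorem tendsto_modes_atTop' : Tendsto Yoshida1992.modes atTop atTop := by
  refine Monotone.tendsto_atTop_atTop (fun M N h ↦ ?_) fun s ↦ ?_
  · intro n hn
    rw [Yoshida1992.mem_modes] at hn ⊢
    exact hn.trans (by exact_mod_cast h)
  · refine ⟨(s.sup fun n ↦ n.natAbs), fun n hn ↦ Yoshida1992.mem_modes.2 ?_⟩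
    have h := Finset.le_sup (f := fun n : ℤ ↦ n.natAbs) hn
    rw [← Int.natCast_natAbs]
    exact_mod_cast h

/-- A finite sum over indices outside `modes N` is bounded by the tail series (non-negative summable
terms). [cite: ConnesConsani2023, proof of Lemma 2.2 (tails of Σ a_k U^k; arXiv chunk p0007:L58–L60), p. 105] -/
private theorem sum_le_tsum_compl {f : ℤ → ℝ} (hf0 : ∀ n, 0 ≤ f n) (hf : Summable f) {N : ℕ}
    {S : Finset ℤ} (hS : ∀ n ∈ S, n ∉ Yoshida1992.modes N) :
    ∑ n ∈ S, f n ≤ ∑' n : {n // n ∉ Yoshida1992.modes N}, f n := by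
  classical
  calc ∑ n ∈ S, f n = ∑ n ∈ S.subtype (fun n ↦ n ∉ Yoshida1992.modes N), f n :=
        (Finset.sum_subtype_of_mem f hS).symm
    _ ≤ ∑' n : {n // n ∉ Yoshida1992.modes N}, f n :=
        (hf.subtype _).sum_le_tsum _ fun n _ ↦ hf0 n

/-- **Step (2.19) of the proof of Lemma 2.2** (PROVED): for `φ ∈ K(a)` the truncated Fourier series
converges to `φ` in the energy norm, `‖(φ − proj a N φ)^‖₁² → 0`.  The energy of the infinite tail is
at most the `liminf` of the energies of the finite tails `Σ_{N<|n|≤M} b_n χ_n` (Fatou), and these are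
`≤ (Σ_{|n|>N} |b_n|(1+|n|)²) · C Σ_{|n|>N} |b_n| → 0` by the weighted Cauchy–Schwarz bound,
`‖χ̂_n‖₁² ≤ C(1+|n|)` and the rapid decay of `b_n = (2a)^{-1/2} c_n(φ)`.
[cite: ConnesConsani2023, proof of Lemma 2.2 eq. (2.19) («one can find N such that η = Σ_{−N}^{N} a_k U^k fulfills (2.19)»; arXiv chunk p0007:L50–L60), p. 105] -/
theorem tendsto_logSobolevEnergy_sub_proj (ha : 0 < a) {φ : ℝ → ℂ} (hφ : φ ∈ Yoshida1992.K a) :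
    Tendsto (fun N ↦ logSobolevEnergy (fun x ↦ φ x - Yoshida1992.proj a N φ x)) atTop (𝓝 0) := by
  obtain ⟨C, hC0, hC⟩ := exists_logSobolevEnergy_chi_le ha
  set b : ℤ → ℂ := fun n ↦ ((1 / Real.sqrt (2 * a) : ℝ) : ℂ) * Yoshida1992.fourierCoeff a n φ
    with hb_def
  set w : ℤ → ℝ := fun n ↦ (1 + |(n : ℝ)|) ^ 2 with hw_def
  have hw : ∀ n, 0 < w n := fun n ↦ by positivity
  have hsa : 0 < 1 / Real.sqrt (2 * a) := by positivity
  have hnb : ∀ n, ‖b n‖ = 1 / Real.sqrt (2 * a) * ‖Yoshida1992.fourierCoeff a n φ‖ := fun n ↦ by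
    rw [hb_def]
    simp only
    rw [norm_mul, Complex.norm_real, Real.norm_of_nonneg hsa.le]
  -- summability from the rapid decay of the coefficients
  have hs0 := Yoshida1992.summable_pow_mul_norm_fourierCoeff ha hφ 0
  have hs1 := Yoshida1992.summable_pow_mul_norm_fourierCoeff ha hφ 1
  have hs2 := Yoshida1992.summable_pow_mul_norm_fourierCoeff ha hφ 2
  have hsb : Summable fun n ↦ ‖b n‖ := by
    have e : (fun n ↦ ‖b n‖) =
        fun n : ℤ ↦ 1 / Real.sqrt (2 * a) * (|(n : ℝ)| ^ 0 * ‖Yoshida1992.fourierCoeff a n φ‖) := by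
      funext n; rw [hnb, pow_zero, one_mul]
    rw [e]
    exact hs0.mul_left _
  have hsbw : Summable fun n ↦ ‖b n‖ * w n := by
    have e : (fun n ↦ ‖b n‖ * w n) = fun n : ℤ ↦ 1 / Real.sqrt (2 * a) *
        (|(n : ℝ)| ^ 0 * ‖Yoshida1992.fourierCoeff a n φ‖ +
          2 * (|(n : ℝ)| ^ 1 * ‖Yoshida1992.fourierCoeff a n φ‖) +
          |(n : ℝ)| ^ 2 * ‖Yoshida1992.fourierCoeff a n φ‖) := by
      funext n; rw [hnb, hw_def]; ring
    rw [e]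
    exact ((hs0.add (hs1.mul_left 2)).add hs2).mul_left _
  -- the tails
  set A : ℕ → ℝ := fun N ↦ ∑' n : {n // n ∉ Yoshida1992.modes N}, ‖b n‖ * w n with hA_def
  set B : ℕ → ℝ := fun N ↦ ∑' n : {n // n ∉ Yoshida1992.modes N}, ‖b n‖ with hB_def
  have hA : Tendsto A atTop (𝓝 0) :=
    (tendsto_tsum_compl_atTop_zero fun n ↦ ‖b n‖ * w n).comp tendsto_modes_atTop'
  have hB : Tendsto B atTop (𝓝 0) :=
    (tendsto_tsum_compl_atTop_zero fun n ↦ ‖b n‖).comp tendsto_modes_atTop'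
  have hA0 : ∀ N, 0 ≤ A N := fun N ↦ tsum_nonneg fun n ↦ mul_nonneg (norm_nonneg _) (hw n.1).le
  have hB0 : ∀ N, 0 ≤ B N := fun N ↦ tsum_nonneg fun _ ↦ norm_nonneg _
  -- window data
  have hφ2 := memLp_and_support_of_mem_K hφ
  have hP : ∀ M, MemLp (Yoshida1992.proj a M φ) 2 volume ∧
      Function.support (Yoshida1992.proj a M φ) ⊆ Icc (-a) a := fun M ↦
    ⟨(mem_formDomain_of_mem_W ha (Yoshida1992.proj_mem_W a M φ)).1,
      (mem_formDomain_of_mem_W ha (Yoshida1992.proj_mem_W a M φ)).2.1⟩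
  -- the main bound, uniform in the finite tails
  have hmain : ∀ N, logSobolevEnergy (fun x ↦ φ x - Yoshida1992.proj a N φ x) ≤
      ENNReal.ofReal (A N) * ENNReal.ofReal (C * B N) := by
    intro N
    have hξ : MemLp (fun x ↦ φ x - Yoshida1992.proj a N φ x) 2 volume ∧
        Function.support (fun x ↦ φ x - Yoshida1992.proj a N φ x) ⊆ Icc (-a) a :=
      ⟨hφ2.1.sub (hP N).1, support_sub_subset_window hφ2.2 (hP N).2⟩
    have hu : ∀ M, MemLp (fun x ↦ Yoshida1992.proj a M φ x - Yoshida1992.proj a N φ x) 2 volume ∧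
        Function.support (fun x ↦ Yoshida1992.proj a M φ x - Yoshida1992.proj a N φ x) ⊆
          Icc (-a) a := fun M ↦
      ⟨(hP M).1.sub (hP N).1, support_sub_subset_window (hP M).2 (hP N).2⟩
    have hconv : Tendsto (fun M ↦ ∫ x, ‖(Yoshida1992.proj a M φ x - Yoshida1992.proj a N φ x) -
        (φ x - Yoshida1992.proj a N φ x)‖) atTop (𝓝 0) := by
      have e : ∀ M, (fun x ↦ ‖(Yoshida1992.proj a M φ x - Yoshida1992.proj a N φ x) -
          (φ x - Yoshida1992.proj a N φ x)‖) = fun x ↦ ‖Yoshida1992.proj a M φ x - φ x‖ := by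
        intro M; funext x; congr 1; ring
      simp_rw [e]
      exact tendsto_integral_norm_proj_sub ha hφ
    refine (logSobolevEnergy_le_liminf_of_tendsto_integral_norm hξ.1 hξ.2 hu hconv).trans ?_
    refine Filter.liminf_le_of_frequently_le' (Filter.Eventually.frequently ?_)
    filter_upwards [eventually_ge_atTop N] with M hNM
    have e : (fun x ↦ Yoshida1992.proj a M φ x - Yoshida1992.proj a N φ x) =
        fun x ↦ ∑ n ∈ Yoshida1992.modes M \ Yoshida1992.modes N, b n * Yoshida1992.chi a n x :=
      funext fun x ↦ proj_sub_proj_eq_sum a hNM φ x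
    rw [e]
    refine (logSobolevEnergy_sum_chi_le a _ b hw).trans ?_
    have hS : ∀ n ∈ Yoshida1992.modes M \ Yoshida1992.modes N, n ∉ Yoshida1992.modes N :=
      fun n hn ↦ (Finset.mem_sdiff.1 hn).2
    have h1 : ∑ n ∈ Yoshida1992.modes M \ Yoshida1992.modes N, ‖b n‖ * w n ≤ A N :=
      sum_le_tsum_compl (fun n ↦ by have := hw n; positivity) hsbw hS
    have h2 : ∑ n ∈ Yoshida1992.modes M \ Yoshida1992.modes N,
        ENNReal.ofReal (‖b n‖ / w n) * logSobolevEnergy (Yoshida1992.chi a n) ≤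
          ENNReal.ofReal (C * B N) := by
      calc ∑ n ∈ Yoshida1992.modes M \ Yoshida1992.modes N,
            ENNReal.ofReal (‖b n‖ / w n) * logSobolevEnergy (Yoshida1992.chi a n)
          ≤ ∑ n ∈ Yoshida1992.modes M \ Yoshida1992.modes N,
              ENNReal.ofReal (‖b n‖ / w n) * ENNReal.ofReal (C * (1 + |(n : ℝ)|)) :=
            Finset.sum_le_sum fun n _ ↦ mul_le_mul' le_rfl (hC n)
        _ ≤ ∑ n ∈ Yoshida1992.modes M \ Yoshida1992.modes N, ENNReal.ofReal (C * ‖b n‖) := by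
            refine Finset.sum_le_sum fun n _ ↦ ?_
            rw [← ENNReal.ofReal_mul (by have := hw n; positivity)]
            refine ENNReal.ofReal_le_ofReal ?_
            rw [hw_def]
            simp only
            have hn1 : (1 : ℝ) ≤ 1 + |(n : ℝ)| := by linarith [abs_nonneg (n : ℝ)]
            have hbn := norm_nonneg (b n)
            rw [div_mul_eq_mul_div, div_le_iff₀ (by positivity)]
            calc ‖b n‖ * (C * (1 + |(n : ℝ)|)) = C * ‖b n‖ * (1 + |(n : ℝ)|) * 1 := by ring
              _ ≤ C * ‖b n‖ * (1 + |(n : ℝ)|) * (1 + |(n : ℝ)|) :=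
                  mul_le_mul_of_nonneg_left hn1 (by positivity)
              _ = C * ‖b n‖ * (1 + |(n : ℝ)|) ^ 2 := by ring
        _ = ENNReal.ofReal (∑ n ∈ Yoshida1992.modes M \ Yoshida1992.modes N, C * ‖b n‖) :=
            (ENNReal.ofReal_sum_of_nonneg fun n _ ↦ by positivity).symm
        _ ≤ ENNReal.ofReal (C * B N) := by
            refine ENNReal.ofReal_le_ofReal ?_
            rw [← Finset.mul_sum]
            exact mul_le_mul_of_nonneg_left
              (sum_le_tsum_compl (fun n ↦ norm_nonneg _) hsb hS) hC0
    exact mul_le_mul' (ENNReal.ofReal_le_ofReal h1) h2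
  -- conclusion
  have hlim : Tendsto (fun N ↦ ENNReal.ofReal (A N) * ENNReal.ofReal (C * B N)) atTop (𝓝 0) := by
    have h1 : Tendsto (fun N ↦ A N * (C * B N)) atTop (𝓝 0) := by
      simpa using hA.mul (hB.const_mul C)
    have h2 := ENNReal.tendsto_ofReal h1
    rw [ENNReal.ofReal_zero] at h2
    refine h2.congr fun N ↦ ?_
    exact ENNReal.ofReal_mul (hA0 N)
  exact tendsto_of_tendsto_of_tendsto_of_le_of_le tendsto_const_nhds hlim (fun _ ↦ bot_le) hmain

end Literature.NumberTheory.ConnesConsani2023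

end
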